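import Summits.AtomisticToContinuum.BoseEinsteinCondensation.Theorems.BoxCountShadowHarnack
import HarnessLib

/-!
# BoxCountShadowFibreTail — continuation of BoxCountShadowHarnack: the INTEGRATED fibre input (§11)

Continuation of `BoxCountShadowHarnack` (same namespace).  TYPING CORRECTION of the SUF-side input: the
sup-type fibre Harnack `GroundStateHorizonFibreHarnack` (FH_h, §9) bounds the block propensity `π_B = q_B/P̂` by a
sup/inf over a WHOLE count fibre and is FALSE-type (expected) by the VOID WITNESS — the others of cell `B` clumped
in a corner leave a void of size `~ℓ_h ≫ ξ` (`ξ = (8πρa)^{-1/2}`, `ℓ_h/ξ = M(8πa)^{1/2}ρ^{-η} → ∞`) whose missing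
correlation hole enhances the tagged particle's propensity by `e^{cℓ_h/ξ}` at fixed `C` (zero-point-phonon Jastrow
tail `u(r) ≍ 1/(ρξr²)`; instanton estimate `μ·τ* ≍ R/ξ`); such arrangements have `P̂`-weight `e^{-c'λℓ_h/ξ}` and are
invisible to INTEGRATED statements.  The typed input is therefore the TAIL statement `GroundStateHorizonFibreTail`
(FHT_h): on typical (count field, block) pairs the part of the fibre where the propensity exceeds `t ×` its fibre
mean carries at most half of the block mass (cross-multiplied, division-free; empty tail in the number-locked model,
so FHT_h ⇏ NUM_h).  PROVED: `setLIntegral_rpow_half_mul_ge_of_tail` (reverse Cauchy–Schwarz from a tail bound),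
`horizonCountDecoupling_of_fibreTail : FHT_h → DEC_h` (`s₀ = (2√t)^{-1}`), `fibreTail_of_fibreHarnack : FH_h → FHT_h`
(the replacement is WEAKER), `bec_of_fibreTail₀ : UGS → LOC_h → NUM_h → FHT_h → BoseEinsteinCondensation`.
No instances, no notation, no sorry.
-/

open MeasureTheory Filter Set
open scoped ENNReal NNReal BigOperators

namespace Summit.AtomisticToContinuum.BoseEinsteinCondensation.Theorems.BoxCountShadow

open Literature.MathematicalPhysics.QuantumManyBody.BoseGas
open Summit.AtomisticToContinuum.BoseEinsteinCondensation.Theorems.BoxLatticeFSum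
open Summit.AtomisticToContinuum.BoseEinsteinCondensation.Theorems.BoxLabelAffinity
open Summit.AtomisticToContinuum.BoseEinsteinCondensation.Theorems.BoxHorizonAffinity

variable {n : ℕ}

section Tail

variable {β : Type*} [MeasurableSpace β]

/-- **Reverse Cauchy–Schwarz from an upper-tail bound**: if the part of `s` where `g/f` exceeds `t ×` its mean
`(∫_s g)/(∫_s f)` (cross-multiplied) carries at most half of `∫_s g`, then
`(2 t^{1/2})^{-1} (∫_s f)^{1/2} (∫_s g)^{1/2} ≤ ∫_s f^{1/2} g^{1/2}`. [folklore] -/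
theorem setLIntegral_rpow_half_mul_ge_of_tail (ν : Measure β) {s : Set β} {f g : β → ℝ≥0∞} (hf : Measurable f)
    (hg : Measurable g) {t : ℝ≥0∞} (ht0 : t ≠ 0) (htt : t ≠ ∞)
    (hQ : ∫⁻ b in s, g b ∂ν ≠ ∞)
    (htail : 2 * ∫⁻ b in s ∩ {b | t * (∫⁻ b' in s, g b' ∂ν) * f b < (∫⁻ b' in s, f b' ∂ν) * g b}, g b ∂ν ≤
      ∫⁻ b in s, g b ∂ν) :
    (2 * t ^ (1 / 2 : ℝ))⁻¹ * ((∫⁻ b in s, f b ∂ν) ^ (1 / 2 : ℝ) * (∫⁻ b in s, g b ∂ν) ^ (1 / 2 : ℝ)) ≤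
      ∫⁻ b in s, f b ^ (1 / 2 : ℝ) * g b ^ (1 / 2 : ℝ) ∂ν := by
  have rpow_half_sq : ∀ m : ℝ≥0∞, (m ^ 2) ^ (1 / 2 : ℝ) = m := fun m => by
    rw [← ENNReal.rpow_two, ← ENNReal.rpow_mul]; norm_num
  set P := ∫⁻ b in s, f b ∂ν with hPdef
  set Q := ∫⁻ b in s, g b ∂ν with hQdef
  set A := ∫⁻ b in s, f b ^ (1 / 2 : ℝ) * g b ^ (1 / 2 : ℝ) ∂ν with hAdef
  set T : Set β := {b | t * Q * f b < P * g b} with hTdef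
  have hT : MeasurableSet T := measurableSet_lt (measurable_const.mul hf) (measurable_const.mul hg)
  have hu : Measurable fun b => f b ^ (1 / 2 : ℝ) * g b ^ (1 / 2 : ℝ) := (hf.pow_const _).mul (hg.pow_const _)
  -- pointwise on the complement of the tail: `P^{1/2} g ≤ (tQ)^{1/2} f^{1/2} g^{1/2}`
  have hpt : ∀ b, b ∉ T →
      P ^ (1 / 2 : ℝ) * g b ≤ (t * Q) ^ (1 / 2 : ℝ) * (f b ^ (1 / 2 : ℝ) * g b ^ (1 / 2 : ℝ)) := by
    intro b hb
    have hle : P * g b ≤ t * Q * f b := not_lt.1 hb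
    have hsq : (P ^ (1 / 2 : ℝ) * g b) ^ 2 ≤ t * Q * (f b * g b) :=
      calc (P ^ (1 / 2 : ℝ) * g b) ^ 2 = (P ^ (1 / 2 : ℝ)) ^ 2 * g b * g b := by ring
        _ = P * g b * g b := by
            rw [← ENNReal.rpow_two, ← ENNReal.rpow_mul, show (1 / 2 * (2 : ℝ)) = 1 by norm_num, ENNReal.rpow_one]
        _ ≤ t * Q * f b * g b := mul_le_mul' hle le_rfl
        _ = t * Q * (f b * g b) := by ring
    have h' := ENNReal.rpow_le_rpow hsq (show (0 : ℝ) ≤ 1 / 2 by norm_num)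
    rw [rpow_half_sq, ENNReal.mul_rpow_of_nonneg _ _ (by norm_num),
      ENNReal.mul_rpow_of_nonneg (f b) _ (by norm_num)] at h'
    exact h'
  -- integrate over `s \ T`
  have hint : P ^ (1 / 2 : ℝ) * ∫⁻ b in s \ T, g b ∂ν ≤ (t * Q) ^ (1 / 2 : ℝ) * A :=
    calc P ^ (1 / 2 : ℝ) * ∫⁻ b in s \ T, g b ∂ν = ∫⁻ b in s \ T, P ^ (1 / 2 : ℝ) * g b ∂ν :=
          (lintegral_const_mul _ hg).symm
      _ ≤ ∫⁻ b in s \ T, (t * Q) ^ (1 / 2 : ℝ) * (f b ^ (1 / 2 : ℝ) * g b ^ (1 / 2 : ℝ)) ∂ν :=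
          setLIntegral_mono ((measurable_const.mul hu)) fun b hb => hpt b hb.2
      _ = (t * Q) ^ (1 / 2 : ℝ) * ∫⁻ b in s \ T, f b ^ (1 / 2 : ℝ) * g b ^ (1 / 2 : ℝ) ∂ν :=
          lintegral_const_mul _ hu
      _ ≤ (t * Q) ^ (1 / 2 : ℝ) * A :=
          mul_le_mul' le_rfl (lintegral_mono_set Set.sdiff_subset)
  -- the tail bound: `Q ≤ 2 ∫_{s \ T} g`
  have hsplit : ∫⁻ b in s ∩ T, g b ∂ν + ∫⁻ b in s \ T, g b ∂ν = Q := lintegral_inter_add_sdiff g s hT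
  have hTfin : ∫⁻ b in s ∩ T, g b ∂ν ≠ ∞ :=
    ne_top_of_le_ne_top hQ (lintegral_mono_set Set.inter_subset_left)
  have hQle : Q ≤ 2 * ∫⁻ b in s \ T, g b ∂ν := by
    have h2 : 2 * ∫⁻ b in s ∩ T, g b ∂ν ≤ ∫⁻ b in s ∩ T, g b ∂ν + ∫⁻ b in s \ T, g b ∂ν := by
      rw [hsplit]; exact htail
    rw [two_mul] at h2
    have h3 : ∫⁻ b in s ∩ T, g b ∂ν ≤ ∫⁻ b in s \ T, g b ∂ν :=
      (ENNReal.add_le_add_iff_left hTfin).1 h2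
    calc Q = ∫⁻ b in s ∩ T, g b ∂ν + ∫⁻ b in s \ T, g b ∂ν := hsplit.symm
      _ ≤ ∫⁻ b in s \ T, g b ∂ν + ∫⁻ b in s \ T, g b ∂ν := add_le_add h3 le_rfl
      _ = 2 * ∫⁻ b in s \ T, g b ∂ν := (two_mul _).symm
  -- combine: `P^{1/2} Q ≤ 2 (tQ)^{1/2} A`
  have hkey : P ^ (1 / 2 : ℝ) * Q ≤ 2 * ((t * Q) ^ (1 / 2 : ℝ) * A) :=
    calc P ^ (1 / 2 : ℝ) * Q ≤ P ^ (1 / 2 : ℝ) * (2 * ∫⁻ b in s \ T, g b ∂ν) := mul_le_mul' le_rfl hQle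
      _ = 2 * (P ^ (1 / 2 : ℝ) * ∫⁻ b in s \ T, g b ∂ν) := by ring
      _ ≤ 2 * ((t * Q) ^ (1 / 2 : ℝ) * A) := mul_le_mul' le_rfl hint
  have ht2 : t ^ (1 / 2 : ℝ) ≠ 0 := (ENNReal.rpow_pos_of_nonneg (pos_iff_ne_zero.2 ht0) (by norm_num)).ne'
  have ht2t : t ^ (1 / 2 : ℝ) ≠ ∞ := ENNReal.rpow_ne_top_of_nonneg (by norm_num) htt
  have hc0 : 2 * t ^ (1 / 2 : ℝ) ≠ 0 := mul_ne_zero two_ne_zero ht2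
  have hct : 2 * t ^ (1 / 2 : ℝ) ≠ ∞ := ENNReal.mul_ne_top ENNReal.ofNat_ne_top ht2t
  by_cases hQ0 : Q = 0
  · rw [hQ0, ENNReal.zero_rpow_of_pos (by norm_num), mul_zero, mul_zero]
    exact bot_le
  · have hQh0 : Q ^ (1 / 2 : ℝ) ≠ 0 := (ENNReal.rpow_pos_of_nonneg (pos_iff_ne_zero.2 hQ0) (by norm_num)).ne'
    have hQht : Q ^ (1 / 2 : ℝ) ≠ ∞ := ENNReal.rpow_ne_top_of_nonneg (by norm_num) hQ
    have hQsq : Q = Q ^ (1 / 2 : ℝ) * Q ^ (1 / 2 : ℝ) := by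
      rw [← ENNReal.rpow_add _ _ hQ0 hQ, show (1 / 2 + 1 / 2 : ℝ) = 1 by norm_num, ENNReal.rpow_one]
    have hkey' : P ^ (1 / 2 : ℝ) * Q ^ (1 / 2 : ℝ) * Q ^ (1 / 2 : ℝ) ≤
        2 * t ^ (1 / 2 : ℝ) * A * Q ^ (1 / 2 : ℝ) :=
      calc P ^ (1 / 2 : ℝ) * Q ^ (1 / 2 : ℝ) * Q ^ (1 / 2 : ℝ) = P ^ (1 / 2 : ℝ) * Q := by rw [mul_assoc, ← hQsq]
        _ ≤ 2 * ((t * Q) ^ (1 / 2 : ℝ) * A) := hkey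
        _ = 2 * t ^ (1 / 2 : ℝ) * A * Q ^ (1 / 2 : ℝ) := by
            rw [ENNReal.mul_rpow_of_nonneg _ _ (by norm_num)]; ring
    have hcancel : P ^ (1 / 2 : ℝ) * Q ^ (1 / 2 : ℝ) ≤ 2 * t ^ (1 / 2 : ℝ) * A :=
      (ENNReal.mul_le_mul_iff_left hQh0 hQht).1 hkey'
    calc (2 * t ^ (1 / 2 : ℝ))⁻¹ * (P ^ (1 / 2 : ℝ) * Q ^ (1 / 2 : ℝ))
        ≤ (2 * t ^ (1 / 2 : ℝ))⁻¹ * (2 * t ^ (1 / 2 : ℝ) * A) := mul_le_mul' le_rfl hcancel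
      _ = A := by rw [← mul_assoc, ENNReal.inv_mul_cancel hc0 hct, one_mul]

end Tail

/-- **FHT_h(η)** (door for DEC_h, REPLACING FH_h of §9 as the typed SUF-side input · TAG STRONGER-or-equal than
DEC_h (PROVED below, `s₀ = (2√t)^{-1}`) · WEAKER-or-equal than FH_h (PROVED below, `t = C`) · MOTT-COMPATIBLE
(a propensity that is a function of the count field has empty tail ⇒ FHT_h ⇏ NUM_h) · UNDECIDED · TRUE-type expected
(self-averaging of the one-particle conditional law at scale `ℓ_h ≫ ξ`) · leaf ATTACKABLE·positivity, class = fibre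
CONCENTRATION of the block propensity (integrated, one coordinate)) `GroundStateHorizonFibreTail η`: on a typical
set `G` of (count field, block) pairs (carrying half of `countAffinity`, as in DEC_h), the part of the fibre
`m(Y) = m` where the block propensity exceeds `t ×` its fibre mean — `{Y : t·Q(B,m)·P̂(Y) < P̄(m)·q_B(Y)}`,
cross-multiplied, no division — carries at most HALF of `Q(B,m) = ∫_{m(Y)=m} q_B`.  Why it might fail: only if the
tagged particle's block propensity is INTERMITTENT on typical fibres (a `q_B`-non-negligible set of arrangements of
the others with equal counts attracting the tagged particle `t`-fold) — the void arrangements that kill FH_h have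
`P̂`-weight `e^{-cλ}` and do not.
[cite: LSSY2005, Thm 7.1; GhoshPeres2017, DOI 10.1215/00127094-2017-0002] -/
@[conjecture] def GroundStateHorizonFibreTail (η : ℝ≥0) : Prop :=
  ∀ v : ℝ → ℝ≥0∞, IsRepulsiveFiniteRange v → 0 < scatteringLength v →
    ∃ M₀ : ℝ, 0 < M₀ ∧ ∀ M : ℝ, M₀ ≤ M → ∃ t : ℝ, 0 < t ∧ ∃ ρ₀ : ℝ, 0 < ρ₀ ∧ ∀ ρ : ℝ, 0 < ρ → ρ < ρ₀ →
      ∀ᶠ n : ℕ in atTop,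
        (∃ Ψ₀ : Config (n + 1) → ℝ, (∀ X, 0 ≤ Ψ₀ X) ∧
          IsGroundState v (sideLength ρ (n + 1)) (fun X => (Ψ₀ X : ℂ))) →
        ∀ K : ℕ, 0 < K → InWindow (M * ρ ^ (-(η : ℝ))) ρ (sideLength ρ (n + 1)) K →
          ∃ G : Set ((SubIdx K → ℕ) × SubIdx K),
            2 * (∑' m : SubIdx K → ℕ, ∑ B : SubIdx K,
                Gᶜ.indicator (countTerm (sideLength ρ (n + 1)) K
                  (groundState v (n + 1) (sideLength ρ (n + 1)))) (m, B)) ≤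
              countAffinity (sideLength ρ (n + 1)) K (groundState v (n + 1) (sideLength ρ (n + 1))) ∧
            ∀ (m : SubIdx K → ℕ) (B : SubIdx K), (m, B) ∈ G →
              2 * ∫⁻ Y in countVec (sideLength ρ (n + 1) / (K : ℝ)) K ⁻¹' {m} ∩
                  {Y | ENNReal.ofReal t *
                      fibreMass (sideLength ρ (n + 1)) K (groundState v (n + 1) (sideLength ρ (n + 1))) B m *
                      sliceSq (groundState v (n + 1) (sideLength ρ (n + 1))) Y <
                    fibreSlice (sideLength ρ (n + 1)) K (groundState v (n + 1) (sideLength ρ (n + 1))) m *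
                      blockMass (sideLength ρ (n + 1)) K (groundState v (n + 1) (sideLength ρ (n + 1))) B Y},
                blockMass (sideLength ρ (n + 1)) K (groundState v (n + 1) (sideLength ρ (n + 1))) B Y ≤
              fibreMass (sideLength ρ (n + 1)) K (groundState v (n + 1) (sideLength ρ (n + 1))) B m

/-- A single block mass has finite integral against a normalised amplitude (`∫ q_B ≤ ∫ P̂ = 1`). [folklore] -/
theorem lintegral_blockMass_le_one {L : ℝ} {K : ℕ} (hL : 0 < L) (hK : 0 < K) {Φ : Config (n + 1) → ℝ}
    (hΦm : Measurable Φ) (hΦ1 : ∫⁻ Y : Config n, ∫⁻ x, ENNReal.ofReal (Φ (Matrix.vecCons x Y)) ^ 2 = 1)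
    (B : SubIdx K) : ∫⁻ Y, blockMass L K Φ B Y ≤ 1 :=
  calc ∫⁻ Y, blockMass L K Φ B Y ≤ ∫⁻ Y, ∑ B' : SubIdx K, blockMass L K Φ B' Y :=
        lintegral_mono fun Y =>
          Finset.single_le_sum (f := fun B' => blockMass L K Φ B' Y) (fun _ _ => bot_le) (Finset.mem_univ B)
    _ ≤ ∫⁻ Y, sliceSq Φ Y := lintegral_mono fun Y => sum_blockMass_le_sliceSq hL hK hΦm Y
    _ = 1 := hΦ1

/-- **FHT_h ⟹ DEC_h** (`s₀ = (2√t)^{-1}`; reverse Cauchy–Schwarz from the tail bound on each typical fibre).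
[folklore] -/
theorem horizonCountDecoupling_of_fibreTail (η : ℝ≥0) (hft : GroundStateHorizonFibreTail η) :
    GroundStateHorizonCountDecoupling η := by
  intro v hv ha
  obtain ⟨M₀, hM₀, h⟩ := hft v hv ha
  refine ⟨M₀, hM₀, fun M hM => ?_⟩
  obtain ⟨t, ht, ρ₀, hρ₀, h'⟩ := h M hM
  refine ⟨(2 * t ^ (1 / 2 : ℝ))⁻¹, inv_pos.2 (mul_pos two_pos (Real.rpow_pos_of_pos ht _)), ρ₀, hρ₀,
    fun ρ hρ hρlt => ?_⟩
  filter_upwards [h' ρ hρ hρlt] with n hn hex K hK hKw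
  have hA : 0 < M * ρ ^ (-(η : ℝ)) := mul_pos (hM₀.trans_le hM) (Real.rpow_pos_of_pos hρ _)
  set L := sideLength ρ (n + 1) with hLdef
  have hL : 0 < L := sideLength_pos_of_inWindow hA hρ hK hKw
  set Φ := groundState v (n + 1) L with hΦdef
  have hΦm : Measurable Φ := measurable_groundState v (n + 1) L
  have hΦ1 : ∫⁻ Y : Config n, ∫⁻ x, ENNReal.ofReal (Φ (Matrix.vecCons x Y)) ^ 2 = 1 := by
    rw [← lintegral_eq_lintegral_lintegral_vecCons (hΦm.ennreal_ofReal.pow_const 2)]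
    exact lintegral_groundState_sq hex
  obtain ⟨G, hG, hT⟩ := hn hex K hK hKw
  refine ⟨G, hG, fun m B hp => ?_⟩
  have htE : ENNReal.ofReal ((2 * t ^ (1 / 2 : ℝ))⁻¹) = (2 * ENNReal.ofReal t ^ (1 / 2 : ℝ))⁻¹ := by
    rw [ENNReal.ofReal_inv_of_pos (mul_pos two_pos (Real.rpow_pos_of_pos ht _)),
      ENNReal.ofReal_mul zero_le_two, ENNReal.ofReal_ofNat, ENNReal.ofReal_rpow_of_nonneg ht.le (by norm_num)]
  rw [htE]
  have hQfin : fibreMass L K Φ B m ≠ ∞ := by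
    refine ne_top_of_le_ne_top ENNReal.one_ne_top ?_
    unfold fibreMass
    exact (lintegral_mono_set (Set.subset_univ _)).trans
      ((setLIntegral_univ _).le.trans (lintegral_blockMass_le_one hL hK hΦm hΦ1 B))
  unfold fibreSlice fibreMass at hT hQfin ⊢
  exact setLIntegral_rpow_half_mul_ge_of_tail volume (measurable_sliceSq hΦm) (measurable_blockMass L K hΦm B)
    (by simpa using ht) ENNReal.ofReal_ne_top hQfin (hT m B hp)

/-- **FH_h ⟹ FHT_h** (`t = C`: under the cross-ratio bound the tail above `C ×` the mean is EMPTY) — the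
integrated statement is WEAKER than the sup-type one it replaces. [folklore] -/
theorem fibreTail_of_fibreHarnack (η : ℝ≥0) (hfh : GroundStateHorizonFibreHarnack η) :
    GroundStateHorizonFibreTail η := by
  intro v hv ha
  obtain ⟨M₀, hM₀, h⟩ := hfh v hv ha
  refine ⟨M₀, hM₀, fun M hM => ?_⟩
  obtain ⟨C, hC, ρ₀, hρ₀, h'⟩ := h M hM
  refine ⟨C, hC, ρ₀, hρ₀, fun ρ hρ hρlt => ?_⟩
  filter_upwards [h' ρ hρ hρlt] with n hn hex K hK hKw
  set L := sideLength ρ (n + 1) with hLdef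
  set Φ := groundState v (n + 1) L with hΦdef
  have hΦm : Measurable Φ := measurable_groundState v (n + 1) L
  obtain ⟨G, hG, hH⟩ := hn hex K hK hKw
  refine ⟨G, hG, fun m B hp => ?_⟩
  set F := countVec (n := n) (L / (K : ℝ)) K ⁻¹' {m} with hFdef
  -- integrate the cross bound in the second variable: on `F`, `P̄ · q_B(Y) ≤ C · Q · P̂(Y)`
  have hmean : ∀ Y ∈ F, fibreSlice L K Φ m * blockMass L K Φ B Y ≤
      ENNReal.ofReal C * fibreMass L K Φ B m * sliceSq Φ Y := by
    intro Y hY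
    unfold fibreSlice fibreMass
    calc (∫⁻ Y' in F, sliceSq Φ Y') * blockMass L K Φ B Y
        = ∫⁻ Y' in F, blockMass L K Φ B Y * sliceSq Φ Y' := by
          rw [mul_comm, lintegral_const_mul _ (measurable_sliceSq hΦm)]
      _ ≤ ∫⁻ Y' in F, ENNReal.ofReal C * (blockMass L K Φ B Y' * sliceSq Φ Y) :=
          setLIntegral_mono (measurable_const.mul ((measurable_blockMass L K hΦm B).mul_const _))
            fun Y' hY' => hH m B hp Y Y' hY hY'
      _ = ENNReal.ofReal C * (∫⁻ Y' in F, blockMass L K Φ B Y') * sliceSq Φ Y := by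
          have hmB : Measurable fun Y' => blockMass L K Φ B Y' * sliceSq Φ Y :=
            (measurable_blockMass L K hΦm B).mul_const _
          rw [lintegral_const_mul _ hmB, lintegral_mul_const _ (measurable_blockMass L K hΦm B), mul_assoc]
  have hempty : F ∩ {Y | ENNReal.ofReal C * fibreMass L K Φ B m * sliceSq Φ Y <
      fibreSlice L K Φ m * blockMass L K Φ B Y} = ∅ := by
    ext Y
    simp only [Set.mem_inter_iff, Set.mem_setOf_eq, Set.mem_empty_iff_false, iff_false, not_and, not_lt]
    exact fun hY => hmean Y hY
  rw [hempty, Measure.restrict_empty, lintegral_zero_measure, mul_zero]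
  exact bot_le

/-- The kernel through the tail door: UGS → LOC_h(η) → NUM_h(η) → FHT_h(η) → `BoseEinsteinCondensation`.
[folklore] -/
theorem bec_of_fibreTail₀ (η : ℝ≥0) (hU : BoxGroundStateUniqueness)
    (hloc : GroundStateHorizonCondensation η) (hnum : GroundStateHorizonCountAffinity η)
    (hft : GroundStateHorizonFibreTail η) : _root_.BoseEinsteinCondensation :=
  bec_of_countDecoupling₀ η hU hloc hnum (horizonCountDecoupling_of_fibreTail η hft)

end Summit.AtomisticToContinuum.BoseEinsteinCondensation.Theorems.BoxCountShadow
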